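import Summits.FinalStateConjecture.FinalStateConjecture.Theorems.PhaseMixingCaptureCaptureSufficesTameNoC0FlatCone
import Mathlib.Analysis.Calculus.Deriv.MeanValue
import HarnessLib

/-!
# `CaptureSufficesTame` (stmt-FinalStateConjecture-17270), line `only-the-third-law-is-generic`, brick F1
# `stub_noC0_flatBasics`: causality of Minkowski space relative to an open set (push-up and lit rays)

For `U ⊆ E4` open and `P ∈ U`, let `J = J(U, P)` be the flat causal future of `P` inside `U`: the points of `U`
that are `P` or the endpoint of a flat causal path from `P` inside `U` (a path `γ : ℝ → E4` on `[a, b]`, `a < b`,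
differentiable at every point of `[a, b]` with `η(γ', γ') ≤ 0`, `γ'⁰ > 0`, `γ t ∈ U`). This file closes the
registered brick `stub_noC0_flatBasics` of skeleton v5 of the line, on top of the cone toolkit
(`…NoC0FlatCone`: cone algebra, cone mean value theorem, gluing, arc velocity):

* the PARABOLIC ARC `t ↦ X + ((t−c)/T)² (Y − X) + ((t−c) − (t−c)²/T) v` from `X` to `Y` on `[c, c + T]` with
  prescribed initial velocity `v` is a flat causal path near the segment `[X, Y]` as soon as `(2/T)(Y − X) − v` is
  future causal (a `C¹` corner rounding: no bump functions, velocities are convex combinations);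
* PUSH-UP INSIDE A BALL `W ⊆ U`: if `X ∈ W` is `P` or the endpoint of a flat causal path from `P`, and `Y ∈ W`
  with `Y − X` future timelike, then a neighbourhood of `Y` consists of endpoints of flat causal paths from `P`
  (old path, then the arc with the old terminal velocity); closure form: `X₀ ∈ closure J` suffices for
  `Y ∈ interior J`;
* (i) PUSH-UP / OPENNESS: if `A ∈ closure J` and a flat TIMELIKE path inside `U` joins `A` to `B`, then
  `B ∈ interior J` — continuous induction along the timelike path `σ`: near `t`, chords of `σ` are future timelike,
  so a closure point `σ t` pushes every slightly later `σ t'` into `interior J`, the set `{t | σ t ∈ closure J}` is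
  closed in `[a, b]`, and at the endpoint one pushes up from a slightly earlier closure point;
* (ii) LIT RAYS ARE BOUNDARY: for a future null `d` and `l₀ ≥ 0` with `P + s d ∈ U` for `s ∈ [0, l₀]`, every
  `P + s d` lies in `closure J` (it lies in `J`: straight null segment) and not in `interior J`: otherwise
  `P + s d − δ ∂₀ ∈ J` for small `δ > 0`, so by the cone mean value theorem `w = s d − δ ∂₀` is future causal with
  `w⁰ = s d⁰ − δ > 0`, contradicting `η(w, w) = 2 s δ d⁰ − δ² > 0`.

References: B. O'Neill, *Semi-Riemannian geometry*, Academic Press 1983, Ch. 5 pp. 146–147, Ch. 10 Prop. 10.46,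
Ch. 14 Cor. 14.1 and Lemma 14.3; S. W. Hawking, G. F. R. Ellis, *The large scale structure of space-time*, CUP 1973,
Prop. 4.5.1 and §6.2; R. Penrose, *Techniques of differential topology in relativity*, SIAM 1972, §2.
-/

-- the doubled `FinalStateConjecture.FinalStateConjecture` path component trips dupNamespace (as in the skeleton)
set_option linter.dupNamespace false

noncomputable section

open scoped Topology
open Set Filter Metric

namespace Summit.FinalStateConjecture.FinalStateConjecture.Theorems.PhaseMixingCaptureCaptureSufficesTame

open Literature.Geometry.Lorentzian

namespace NoC0Flat

/-! ## The parabolic arc and push-up inside a ball -/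

/-- **The parabolic arc is a flat causal path near the segment.** For `v` future causal with `v⁰ > 0`, `T > 0`,
`z = (2/T)(Y − X) − v` future causal with `z⁰ > 0`, and `X, Y ∈ ball c₀ r'` with `r' + T‖v‖ ≤ r`, `ball c₀ r ⊆ U`:
the arc `t ↦ X + ((t−c)/T)² (Y − X) + ((t−c) − (t−c)²/T) v` is a flat causal path inside `U` on `[c, c + T]` from
`X` to `Y` with initial velocity `v` (velocity = convex combination of `v` and `z`; position = a point of the
segment `[X, Y]` displaced by at most `T‖v‖`). A `C¹` corner rounding with prescribed incoming velocity, as in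
the smoothing of causal trips (O'Neill 1983, Ch. 10, Lemma 10.45 and Prop. 10.46; Penrose 1972, §2).
[cite: ONeill1983, Ch. 10, Prop. 10.46] -/
theorem arc_causalPath {U : Set E4} {X Y v c₀ : E4} {r r' T : ℝ} (c : ℝ)
    (hv : Minkowski.bilin v v ≤ 0) (hv0 : 0 < v 0) (hT : 0 < T)
    (hz : Minkowski.bilin ((2 / T) • (Y - X) - v) ((2 / T) • (Y - X) - v) ≤ 0)
    (hz0 : 0 < ((2 / T) • (Y - X) - v) 0)
    (hX : X ∈ ball c₀ r') (hY : Y ∈ ball c₀ r') (hr : r' + T * ‖v‖ ≤ r) (hU : ball c₀ r ⊆ U) :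
    (∀ t ∈ Set.Icc c (c + T), (fun t ↦ X + ((t - c) / T) ^ 2 • (Y - X) + ((t - c) - (t - c) ^ 2 / T) • v) t ∈ U ∧
      ∃ w : E4, HasDerivAt (fun t ↦ X + ((t - c) / T) ^ 2 • (Y - X) + ((t - c) - (t - c) ^ 2 / T) • v) w t ∧
        Minkowski.bilin w w ≤ 0 ∧ 0 < w 0) ∧
    (fun t ↦ X + ((t - c) / T) ^ 2 • (Y - X) + ((t - c) - (t - c) ^ 2 / T) • v) c = X ∧
    (fun t ↦ X + ((t - c) / T) ^ 2 • (Y - X) + ((t - c) - (t - c) ^ 2 / T) • v) (c + T) = Y ∧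
    HasDerivAt (fun t ↦ X + ((t - c) / T) ^ 2 • (Y - X) + ((t - c) - (t - c) ^ 2 / T) • v) v c := by
  refine ⟨fun t ht ↦ ⟨?_, _, hasDerivAt_arc X Y v c T t hT.ne', ?_⟩, by simp, ?_, ?_⟩
  · -- position: inside `ball c₀ r ⊆ U`
    apply hU
    have hs0 : 0 ≤ (t - c) / T := div_nonneg (by linarith [ht.1]) hT.le
    have hs1 : (t - c) / T ≤ 1 := (div_le_one hT).2 (by linarith [ht.2])
    have hseg : X + ((t - c) / T) ^ 2 • (Y - X) ∈ ball c₀ r' :=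
      (convex_ball c₀ r').add_smul_sub_mem hX hY ⟨sq_nonneg _, pow_le_one₀ hs0 hs1⟩
    have hcoef0 : 0 ≤ (t - c) - (t - c) ^ 2 / T := by
      have : (t - c) - (t - c) ^ 2 / T = (t - c) * (1 - (t - c) / T) := by field_simp
      rw [this]
      exact mul_nonneg (by linarith [ht.1]) (by linarith)
    have hcoef1 : (t - c) - (t - c) ^ 2 / T ≤ T := by
      have : 0 ≤ (t - c) ^ 2 / T := div_nonneg (sq_nonneg _) hT.le
      linarith [ht.2]
    have hnorm : ‖((t - c) - (t - c) ^ 2 / T) • v‖ ≤ T * ‖v‖ := by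
      rw [norm_smul, Real.norm_eq_abs, abs_of_nonneg hcoef0]
      exact mul_le_mul_of_nonneg_right hcoef1 (norm_nonneg _)
    rw [mem_ball] at hseg ⊢
    calc dist (X + ((t - c) / T) ^ 2 • (Y - X) + ((t - c) - (t - c) ^ 2 / T) • v) c₀
        ≤ dist (X + ((t - c) / T) ^ 2 • (Y - X) + ((t - c) - (t - c) ^ 2 / T) • v)
            (X + ((t - c) / T) ^ 2 • (Y - X)) + dist (X + ((t - c) / T) ^ 2 • (Y - X)) c₀ :=
          dist_triangle _ _ _
      _ = ‖((t - c) - (t - c) ^ 2 / T) • v‖ + dist (X + ((t - c) / T) ^ 2 • (Y - X)) c₀ := by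
          rw [dist_self_add_left]
      _ < T * ‖v‖ + r' := add_lt_add_of_le_of_lt hnorm hseg
      _ ≤ r := by linarith
  · -- velocity: a convex combination of the future causal vectors `v` and `z`
    have hs0 : 0 ≤ (t - c) / T := div_nonneg (by linarith [ht.1]) hT.le
    have hs1 : (t - c) / T ≤ 1 := (div_le_one hT).2 (by linarith [ht.2])
    exact causal_combo hv hv0 hz hz0 (by linarith) hs0 (by linarith)
  · simp only [add_sub_cancel_left]
    rw [div_self hT.ne', one_pow, one_smul]
    have : T - T ^ 2 / T = 0 := by field_simp; ring
    rw [this, zero_smul, add_zero, add_sub_cancel]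
  · have := hasDerivAt_arc X Y v c T c hT.ne'
    simpa using this

/-- **Push-up inside a ball, path form.** Let `ball c₀ r ⊆ U`, `X, Y ∈ ball c₀ r` with `Y − X` future timelike, and
suppose `X = P` or `X` is the endpoint of a flat causal path from `P` inside `U`. Then every point `Y'` of a
neighbourhood of `Y` is the endpoint of a flat causal path from `P` inside `U` (follow the old path, then the
parabolic arc from `X` to `Y'` with the old terminal velocity; O'Neill 1983, Ch. 10, Prop. 10.46 and Ch. 14,
Cor. 14.1, flat case relative to an open set). [cite: ONeill1983, Ch. 14, Cor. 14.1] -/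
theorem exists_ball_forall_causalPath {U : Set E4} {P X Y c₀ : E4} {r : ℝ} (hU : ball c₀ r ⊆ U)
    (hX : X ∈ ball c₀ r) (hY : Y ∈ ball c₀ r)
    (hXP : X = P ∨ ∃ (γ : ℝ → E4) (a b : ℝ), a < b ∧ γ a = P ∧ γ b = X ∧
      ∀ t ∈ Set.Icc a b, γ t ∈ U ∧ ∃ w : E4, HasDerivAt γ w t ∧ Minkowski.bilin w w ≤ 0 ∧ 0 < w 0)
    (hYX : Minkowski.bilin (Y - X) (Y - X) < 0) (hYX0 : 0 < (Y - X) 0) :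
    ∃ ρ > 0, ∀ Y' ∈ ball Y ρ,
      ∃ (γ : ℝ → E4) (a b : ℝ), a < b ∧ γ a = P ∧ γ b = Y' ∧
        ∀ t ∈ Set.Icc a b, γ t ∈ U ∧ ∃ w : E4, HasDerivAt γ w t ∧ Minkowski.bilin w w ≤ 0 ∧ 0 < w 0 := by
  -- the initial velocity `v` of the new arc: the old terminal velocity, or `Y − X` at the vertex
  obtain ⟨v, hv, hv0, hvX⟩ : ∃ v : E4, Minkowski.bilin v v ≤ 0 ∧ 0 < v 0 ∧
      (X = P ∨ ∃ (γ : ℝ → E4) (a b : ℝ), a < b ∧ γ a = P ∧ γ b = X ∧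
        (∀ t ∈ Set.Icc a b, γ t ∈ U ∧ ∃ w : E4, HasDerivAt γ w t ∧ Minkowski.bilin w w ≤ 0 ∧ 0 < w 0) ∧
        HasDerivAt γ v b) := by
    rcases hXP with hXP | ⟨γ, a, b, hab, hγa, hγb, hγ⟩
    · exact ⟨Y - X, hYX.le, hYX0, Or.inl hXP⟩
    · obtain ⟨-, v, hvd, hv, hv0⟩ := hγ b (right_mem_Icc.2 hab.le)
      exact ⟨v, hv, hv0, Or.inr ⟨γ, a, b, hab, hγa, hγb, hγ, hvd⟩⟩
  -- room in the ball and in the timecone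
  obtain ⟨r', hr'l, hr'r⟩ := exists_between (max_lt (mem_ball.1 hX) (mem_ball.1 hY))
  obtain ⟨hXr', hYr'⟩ := max_lt_iff.1 hr'l
  obtain ⟨ε, hε, hcone⟩ := exists_timecone_margin hYX hYX0
  set m : ℝ := min ε (r - r') with hm
  have hm0 : 0 < m := lt_min hε (by linarith)
  set T : ℝ := m / (2 * (‖v‖ + 1)) with hTdef
  have hv1 : 0 < ‖v‖ + 1 := by positivity
  have hT : 0 < T := by positivity
  have hTv : T * ‖v‖ ≤ m / 2 := by
    rw [hTdef, div_mul_eq_mul_div, div_le_div_iff₀ (by positivity) two_pos]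
    nlinarith [norm_nonneg v, hm0]
  refine ⟨min (r' - dist Y c₀) (ε / 2), lt_min (by linarith) (by linarith), fun Y' hY' ↦ ?_⟩
  rw [mem_ball, lt_min_iff] at hY'
  have hY'r' : Y' ∈ ball c₀ r' := by
    rw [mem_ball]
    linarith [dist_triangle Y' Y c₀]
  -- the target velocity `z = (2/T)(Y' − X) − v = (2/T)((Y' − X) − (T/2) v)` is future timelike
  have hu : Minkowski.bilin ((Y' - X) - (T / 2) • v) ((Y' - X) - (T / 2) • v) < 0 ∧
      0 < ((Y' - X) - (T / 2) • v) 0 := by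
    apply hcone
    have h1 : dist ((Y' - X) - (T / 2) • v) (Y - X) ≤ dist Y' Y + ‖(T / 2) • v‖ := by
      rw [dist_eq_norm, dist_eq_norm]
      have : (Y' - X) - (T / 2) • v - (Y - X) = (Y' - Y) - (T / 2) • v := by abel
      rw [this]
      exact norm_sub_le _ _
    have h2 : ‖(T / 2) • v‖ = T / 2 * ‖v‖ := by
      rw [norm_smul, Real.norm_eq_abs, abs_of_pos (by positivity)]
    have h3 : m ≤ ε := min_le_left _ _
    linarith
  have hz := timelike_smul hu.1 hu.2 (show (0 : ℝ) < 2 / T by positivity)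
  have hzeq : (2 / T) • ((Y' - X) - (T / 2) • v) = (2 / T) • (Y' - X) - v := by
    rw [smul_sub, smul_smul]
    rw [show (2 / T) * (T / 2) = 1 by field_simp, one_smul]
  rw [hzeq] at hz
  have hrr : r' + T * ‖v‖ ≤ r := by
    have : m ≤ r - r' := min_le_right _ _
    linarith
  rcases hvX with hXP | ⟨γ, a, b, hab, hγa, hγb, hγ, hvd⟩
  · -- at the vertex: the arc alone
    obtain ⟨hpath, h0, h1, -⟩ := arc_causalPath (U := U) 0 hv hv0 hT hz.1.le hz.2 hXr' hY'r' hrr hU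
    exact ⟨_, 0, 0 + T, by linarith, h0.trans hXP, h1, hpath⟩
  · -- after a path: old path, then the arc with the old terminal velocity
    obtain ⟨hpath, h0, h1, hd⟩ := arc_causalPath (U := U) b hv hv0 hT hz.1.le hz.2 hXr' hY'r' hrr hU
    refine ⟨fun t ↦ if t ≤ b then γ t else
        X + ((t - b) / T) ^ 2 • (Y' - X) + ((t - b) - (t - b) ^ 2 / T) • v, a, b + T, by linarith,
      by simp [hab.le, hγa], ?_, causalPath_append hγ hpath hvd hd (hγb.trans h0.symm)⟩
    have hlt : ¬ b + T ≤ b := by linarith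
    simp only [hlt, if_false]
    exact h1

/-- **Push-up inside a ball, closure form (openness of the relative chronological future of `closure J`).** Let
`J = J(U, P)` be the flat causal future of `P` inside `U`, `ball c₀ r ⊆ U`, `X₀, Y ∈ ball c₀ r` with
`X₀ ∈ closure J` and `Y − X₀` future timelike. Then `Y ∈ interior J` (approximate `X₀` by `X ∈ J` keeping `Y − X`
future timelike, then the path form; O'Neill 1983, Ch. 14, Cor. 14.1, flat case relative to an open set).
[cite: ONeill1983, Ch. 14, Cor. 14.1] -/
theorem mem_interior_flatJ_of_timelike {U J : Set E4} {P X₀ Y c₀ : E4} {r : ℝ}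
    (hJ : J = {Y | Y ∈ U ∧ (Y = P ∨ ∃ (γ : ℝ → E4) (a b : ℝ), a < b ∧ γ a = P ∧ γ b = Y ∧
      ∀ t ∈ Set.Icc a b, γ t ∈ U ∧ ∃ v : E4, HasDerivAt γ v t ∧ Minkowski.bilin v v ≤ 0 ∧ 0 < v 0)})
    (hU : ball c₀ r ⊆ U) (hX₀ : X₀ ∈ ball c₀ r) (hY : Y ∈ ball c₀ r) (hcl : X₀ ∈ closure J)
    (hYX : Minkowski.bilin (Y - X₀) (Y - X₀) < 0) (hYX0 : 0 < (Y - X₀) 0) : Y ∈ interior J := by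
  subst hJ
  obtain ⟨ε, hε, hcone⟩ := exists_timecone_margin hYX hYX0
  have hδ : 0 < min ε (r - dist X₀ c₀) := lt_min hε (by linarith [mem_ball.1 hX₀])
  obtain ⟨X, hXJ, hXd⟩ := Metric.mem_closure_iff.1 hcl _ hδ
  rw [lt_min_iff] at hXd
  have hXr : X ∈ ball c₀ r := by
    rw [mem_ball]
    linarith [dist_triangle X X₀ c₀, dist_comm X X₀]
  have hYX' : Minkowski.bilin (Y - X) (Y - X) < 0 ∧ 0 < (Y - X) 0 := by
    apply hcone
    rw [dist_eq_norm, show Y - X - (Y - X₀) = X₀ - X by abel, ← dist_eq_norm]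
    exact hXd.1
  obtain ⟨-, hXP⟩ := hXJ
  obtain ⟨ρ, hρ, hball⟩ := exists_ball_forall_causalPath hU hXr hY hXP hYX'.1 hYX'.2
  rw [mem_interior_iff_mem_nhds]
  refine mem_of_superset (ball_mem_nhds Y hρ) fun Y' hY' ↦ ?_
  obtain ⟨γ, a, b, hab, hγa, hγb, hγ⟩ := hball Y' hY'
  refine ⟨?_, Or.inr ⟨γ, a, b, hab, hγa, hγb, hγ⟩⟩
  rw [← hγb]
  exact (hγ b (right_mem_Icc.2 hab.le)).1

/-! ## The two parts of brick F1 -/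

/-- **Push-up / openness of the relative causal future (part (i) of brick F1).** For `U` open, if
`A ∈ closure J(U, P)` and a flat timelike path inside `U` joins `A` to `B`, then `B ∈ interior J(U, P)`
(continuous induction along the path with the push-up inside balls; O'Neill 1983, Ch. 14, Cor. 14.1, for `ℝ⁴₁`
relative to an open set). [cite: ONeill1983, Ch. 14, Cor. 14.1] -/
theorem mem_interior_flatJ_of_timelikePath {U J : Set E4} (hU : IsOpen U) {P A B : E4}
    (hJ : J = {Y | Y ∈ U ∧ (Y = P ∨ ∃ (γ : ℝ → E4) (a b : ℝ), a < b ∧ γ a = P ∧ γ b = Y ∧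
      ∀ t ∈ Set.Icc a b, γ t ∈ U ∧ ∃ v : E4, HasDerivAt γ v t ∧ Minkowski.bilin v v ≤ 0 ∧ 0 < v 0)})
    (hAcl : A ∈ closure J)
    (hAB : ∃ (γ : ℝ → E4) (a b : ℝ), a < b ∧ γ a = A ∧ γ b = B ∧
      ∀ t ∈ Set.Icc a b, γ t ∈ U ∧ ∃ v : E4, HasDerivAt γ v t ∧ Minkowski.bilin v v < 0 ∧ 0 < v 0) :
    B ∈ interior J := by
  obtain ⟨σ, a, b, hab, rfl, rfl, hσ⟩ := hAB
  have hcont : ContinuousOn σ (Icc a b) := fun t ht ↦ by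
    obtain ⟨-, v, hv, -⟩ := hσ t ht
    exact hv.continuousAt.continuousWithinAt
  -- the local data at a parameter `t`: a ball around `σ t` inside `U` and timelike chords near `t`
  have key : ∀ t ∈ Icc a b, ∃ r > 0, ball (σ t) r ⊆ U ∧ ∀ᶠ t' in 𝓝 t, σ t' ∈ ball (σ t) r ∧
      (t < t' → Minkowski.bilin (σ t' - σ t) (σ t' - σ t) < 0 ∧ 0 < (σ t' - σ t) 0) ∧
      (t' < t → Minkowski.bilin (σ t - σ t') (σ t - σ t') < 0 ∧ 0 < (σ t - σ t') 0) := by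
    intro t ht
    obtain ⟨hUt, v, hv, hvv, hv0⟩ := hσ t ht
    obtain ⟨r, hr, hball⟩ := Metric.isOpen_iff.1 hU (σ t) hUt
    exact ⟨r, hr, hball, (hv.continuousAt.eventually_mem (ball_mem_nhds _ hr)).and
      (eventually_chord_timelike hv hvv hv0)⟩
  -- Step 1 (continuous induction): every point of the path lies in `closure J`
  have hIcc : Icc a b ⊆ {t | σ t ∈ closure J} := by
    refine IsClosed.Icc_subset_of_forall_mem_nhdsWithin ?_ hAcl ?_
    · have hcl := hcont.preimage_isClosed_of_isClosed isClosed_Icc (isClosed_closure (s := J))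
      rwa [inter_comm] at hcl
    · rintro t ⟨htS, htI⟩
      obtain ⟨r, hr, hball, hev⟩ := key t (Ico_subset_Icc_self htI)
      have hev' : ∀ᶠ t' in 𝓝[>] t, t' ∈ Ioo t b := Ioo_mem_nhdsGT htI.2
      filter_upwards [eventually_nhdsWithin_of_eventually_nhds hev, hev'] with t' h1 h2
      exact subset_closure (interior_subset (mem_interior_flatJ_of_timelike hJ hball
        (mem_ball_self hr) h1.1 htS (h1.2.1 h2.1).1 (h1.2.1 h2.1).2))
  -- Step 2: push up to the endpoint from a closure point slightly before it
  obtain ⟨r, hr, hball, hev⟩ := key b (right_mem_Icc.2 hab.le)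
  have hev' : ∀ᶠ t' in 𝓝[<] b, t' ∈ Ioo a b := Ioo_mem_nhdsLT hab
  obtain ⟨t', h1, h2⟩ := ((eventually_nhdsWithin_of_eventually_nhds hev).and hev').exists
  exact mem_interior_flatJ_of_timelike hJ hball h1.1 (mem_ball_self hr) (hIcc (Ioo_subset_Icc_self h2))
    (h1.2.2 h2.2).1 (h1.2.2 h2.2).2

/-- **Lit rays are boundary (part (ii) of brick F1).** For a future null `d` (`η(d, d) = 0`, `d⁰ > 0`) and
`l₀ ≥ 0` with `P + s d ∈ U` for all `s ∈ [0, l₀]`: every such `P + s d` lies in `closure J(U, P)` (indeed in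
`J(U, P)`, along the straight null segment) and not in `interior J(U, P)` (achronality of null lines of `ℝ⁴₁`: a
point `P + s d − δ ∂₀` of `J` would make `s d − δ ∂₀` future causal with positive time component by the cone mean
value theorem, but `η(s d − δ ∂₀, s d − δ ∂₀) = 2 s δ d⁰ − δ² > 0` once `s d⁰ > δ`; O'Neill 1983, Ch. 14,
Lemma 14.3; Hawking–Ellis 1973, Prop. 4.5.1). [cite: ONeill1983, Ch. 14, Lemma 14.3] -/
theorem ray_mem_closure_not_mem_interior {U J : Set E4} {P d : E4}
    (hJ : J = {Y | Y ∈ U ∧ (Y = P ∨ ∃ (γ : ℝ → E4) (a b : ℝ), a < b ∧ γ a = P ∧ γ b = Y ∧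
      ∀ t ∈ Set.Icc a b, γ t ∈ U ∧ ∃ v : E4, HasDerivAt γ v t ∧ Minkowski.bilin v v ≤ 0 ∧ 0 < v 0)})
    (hd : Minkowski.bilin d d = 0) (hd0 : 0 < d 0) {l₀ : ℝ} (hseg : ∀ s ∈ Icc 0 l₀, P + s • d ∈ U) {s : ℝ}
    (hs : s ∈ Icc 0 l₀) : P + s • d ∈ closure J ∧ P + s • d ∉ interior J := by
  subst hJ
  constructor
  · apply subset_closure
    refine ⟨hseg s hs, ?_⟩
    rcases hs.1.eq_or_lt with h0 | hpos
    · left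
      rw [← h0]
      simp
    · right
      refine ⟨fun t ↦ P + t • d, 0, s, hpos, by simp, rfl, fun t ht ↦
        ⟨hseg t ⟨ht.1, ht.2.trans hs.2⟩, d, ?_, hd.le, hd0⟩⟩
      have h := ((hasDerivAt_id' t).smul_const d).const_add P
      simpa using h
  · intro hint
    rw [mem_interior_iff_mem_nhds, Metric.mem_nhds_iff] at hint
    obtain ⟨ρ, hρ, hball⟩ := hint
    have hQ := hball (show P + s • d - (ρ / 2) • E4.basisVector 0 ∈ ball (P + s • d) ρ by
      rw [mem_ball, dist_eq_norm]
      have h1 : P + s • d - (ρ / 2) • E4.basisVector 0 - (P + s • d) = -((ρ / 2) • E4.basisVector 0) := by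
        abel
      have h2 : ‖(E4.basisVector 0 : E4)‖ = 1 := by simp [E4.basisVector]
      rw [h1, norm_neg, norm_smul, h2, Real.norm_eq_abs, abs_of_pos (by positivity)]
      linarith)
    obtain ⟨hw, hw0⟩ := bilin_ray_sub_basisVector hd s (ρ / 2)
    have heq : P + s • d - (ρ / 2) • E4.basisVector 0 - P = s • d - (ρ / 2) • E4.basisVector 0 := by abel
    obtain ⟨-, hQP | ⟨γ, a, b, hab, hγa, hγb, hγ⟩⟩ := hQ
    · -- the vertex itself: `s d − (ρ/2) ∂₀ = 0`, impossible for `d` null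
      have hzero : s • d - (ρ / 2) • E4.basisVector 0 = 0 := by rw [← heq, hQP, sub_self]
      rw [hzero, map_zero] at hw
      rw [hzero] at hw0
      simp only [PiLp.zero_apply] at hw hw0
      nlinarith
    · -- a flat causal path from `P`: the chord `s d − (ρ/2) ∂₀` is future causal with positive time component
      have hc := causal_chord_of_causalPath hab fun t ht ↦ (hγ t ht).2
      rw [hγa, hγb, heq, hw] at hc
      obtain ⟨hc1, hc2⟩ := hc
      have ht0 : (P + s • d - (ρ / 2) • E4.basisVector 0) 0 = P 0 + (s * d 0 - ρ / 2) := by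
        have : P + s • d - (ρ / 2) • E4.basisVector 0 = P + (s • d - (ρ / 2) • E4.basisVector 0) := by abel
        rw [this, PiLp.add_apply, hw0]
      rw [ht0] at hc2
      nlinarith

end NoC0Flat

open NoC0Flat in
/-- **Brick F1 `stub_noC0_flatBasics` — CAUSALITY OF MINKOWSKI SPACE RELATIVE TO AN OPEN SET (push-up and lit
rays).** For `U ⊆ E4` open and `P ∈ U`, with `J = J(U, P)` the flat causal future of `P` inside `U`:
(i) PUSH-UP / OPENNESS: if `A ∈ closure J`, `A, B ∈ U`, and a flat TIMELIKE path inside `U` joins `A` to `B`, then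
`B ∈ interior J`; (ii) LIT RAYS ARE BOUNDARY: for a future null `d` (`η(d, d) = 0`, `d⁰ > 0`) and `l₀ ≥ 0` with
`P + λ d ∈ U` for all `λ ∈ [0, l₀]`, every such `P + λ d` lies in `closure J` and NOT in `interior J`.
Registered stub of skeleton v5 of line `only-the-third-law-is-generic` (crux `CaptureSufficesTame`), proved from
`NoC0Flat.mem_interior_flatJ_of_timelikePath` and `NoC0Flat.ray_mem_closure_not_mem_interior`.
O'Neill 1983, Ch. 5, pp. 146–147 and Ch. 14, Cor. 14.1, Lemma 14.3 (for `ℝ⁴₁`, relative to an open set).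
[cite: ONeill1983, Ch. 14, Cor. 14.1 and Lemma 14.3] -/
theorem stub_noC0_flatBasics :
    ∀ (U : Set E4), IsOpen U → ∀ P ∈ U, ∀ J : Set E4,
      J = {Y | Y ∈ U ∧ (Y = P ∨ ∃ (γ : ℝ → E4) (a b : ℝ), a < b ∧ γ a = P ∧ γ b = Y ∧
            ∀ t ∈ Set.Icc a b, γ t ∈ U ∧ ∃ v : E4, HasDerivAt γ v t ∧ Minkowski.bilin v v ≤ 0 ∧ 0 < v 0)} →
      (∀ A B : E4, A ∈ U → B ∈ U → A ∈ closure J →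
        (∃ (γ : ℝ → E4) (a b : ℝ), a < b ∧ γ a = A ∧ γ b = B ∧
            ∀ t ∈ Set.Icc a b, γ t ∈ U ∧ ∃ v : E4, HasDerivAt γ v t ∧ Minkowski.bilin v v < 0 ∧ 0 < v 0) →
        B ∈ interior J) ∧
      (∀ d : E4, Minkowski.bilin d d = 0 → 0 < d 0 → ∀ l₀ : ℝ, 0 ≤ l₀ →
        (∀ s ∈ Set.Icc 0 l₀, P + s • d ∈ U) →
        ∀ s ∈ Set.Icc 0 l₀, P + s • d ∈ closure J ∧ P + s • d ∉ interior J) := by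
  intro U hU P _hP J hJ
  exact ⟨fun A B _hA _hB hAcl hAB ↦ mem_interior_flatJ_of_timelikePath hU hJ hAcl hAB,
    fun d hd hd0 l₀ _hl₀ hseg s hs ↦ ray_mem_closure_not_mem_interior hJ hd hd0 hseg hs⟩

end Summit.FinalStateConjecture.FinalStateConjecture.Theorems.PhaseMixingCaptureCaptureSufficesTame

end
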